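import Literature.Computability.AlgebraicComplexity.TavenasDepthFourProofs
import Literature.Computability.AlgebraicComplexity.DetInVP
import Summits.ValiantsHypothesis.ValiantsHypothesis.Theorems.RyserFormula
import HarnessLib

/-!
# Depth4 — the door axis from ABOVE: the crux's `det` twin is FALSE, `per`'s Ryser ceiling
# (support for crux `Depth4HomFour` = `stmt-ValiantsHypothesis-11333`; lens 4, g31, O24 GO-REDUCED)

CALIBRATION of the door axis from above; NOT a rung; 0 S-currency; closes no item; crux 11333 /
the fixed-slope window / VP ≠ VNP untouched.

Crux `Depth4HomFour` asks `∀ c ∃ n, (n+2)^(c⌊√n⌋+c) < homDepthFourCircuitSize (perPoly (Fin n) ℂ)`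
(GATES of homogeneous `ΣΠΣΠ` circuits, Kumar–Saraf's discipline).  The lineage so far has LOWER
rungs (rung one p812576 and its `det` twin p813782, rung 1¼ p815841 — all `VP`-saturated) and
method walls (KS counting wall p804055, LST cap p811386).  This file records the UPPER side:

* (A) `exists_door_detPoly`: `∃ c₀ ∀ m, homDepthFourCircuitSize det_m ≤ (m+2)^(c₀⌊√m⌋+c₀)` over
  every commutative ring — the det ceiling is Tavenas ∘ DET ∈ VP BY NAME (constant 50(a+2)+40-type,
  not explicit); the explicit slope-2 Mahajan–Vinay block split is NOT in this file (sketch de153f40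
  banked).  Hence **the `det` twin of the crux is FALSE** (`not_depth4HomFour_detTwin`: the crux
  body with `perPoly ↦ detPoly` is refuted): crux 11333 is `per`-SPECIFIC in kernel, while rung one
  and rung 1¼ hold verbatim for `det` — every argument that cannot tell `per_n` from `det_n` stops
  below the crux.
* (B) `homDepthFourCircuitSize_perPoly_le`: `homDepthFourCircuitSize per_n ≤ n² + (n+1)·2^n + 1`
  (Ryser's formula as `2^n` products of `n` linear forms, a homogeneous `ΣΠΣ ⊂ ΣΠΣΠ` circuit built
  with the tree's `DepthReduction.exists_depthFour_circuit_sum_prod`) — the top of `per`'s window.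
* (C) `depth4HomFour_separates`: `Depth4HomFour ⟹ ∃ n, homDepthFourCircuitSize det_n <
  homDepthFourCircuitSize per_n` (witness: the crux at the door `c₀` of (A)).  (C) is a
  REFORMULATION of per-specificity, not progress on 11333.

HONEST GRADE: maths KNOWN (Tavenas 2015 Thm 1 ∘ `DET ∈ VP`; Ryser 1963 Ch. 2 Thm 4.1; Kumar–Saraf
2017 §1 tightness remark); KERNEL-NEW only as the first upper bounds on `homDepthFourCircuitSize`
of `det`/`per` in the tree; NOT a rung; 0 S-currency; closes no item; `VP ≠ VNP` is NOT proved by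
anything here.

## References
* [Tavenas2015] S. Tavenas, Improved bounds for reduction to depth 4 and depth 3, Inform. Comput.
  240 (2015), Thm 1.
* [Ryser1963] H. J. Ryser, Combinatorial Mathematics (1963), Ch. 2 Thm 4.1.
* [KumarSaraf2017] M. Kumar, S. Saraf, On the power of homogeneous depth 4 arithmetic circuits,
  SIAM J. Comput. 46 (2017), §1 and §3.
-/

set_option linter.dupNamespace false

noncomputable section

open MvPolynomial Finset Literature.Computability.AlgebraicComplexity

namespace Summit.ValiantsHypothesis.ValiantsHypothesis.Theorems.Depth4DoorCeilings

/-! ### (A) The ceiling of `det` on the door axis; the `det` twin of the crux is false -/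

section DetCeiling

variable (K : Type*) [CommRing K]

/-- The qualitative door ceiling of `det`: Tavenas' depth-4 bound for `VP` families
(`DepthReduction.homDepthFourCircuitSize_le_of_isVPFamily`, constant `50(a+2)+40`) with `DET ∈ VP`
(`isVPFamily_detPoly_of_commRing`), by name. [cite: Tavenas2015, Thm 1] -/
theorem exists_door_detPoly :
    ∃ c : ℕ, ∀ m : ℕ,
      homDepthFourCircuitSize (detPoly (Fin m) K) ≤ ((m + 2 : ℕ∞) ^ (c * Nat.sqrt m + c)) := by
  classical
  -- `det_m` is homogeneous of degree `m`; its total degree is `m` unless it vanishes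
  have hdeg : ∀ m, detPoly (Fin m) K ≠ 0 → (detPoly (Fin m) K).totalDegree = m := fun m h0 => by
    have hh : (detPoly (Fin m) K).IsHomogeneous m := by
      simpa using detPoly_isHomogeneous (n := Fin m) (k := K)
    exact hh.totalDegree h0
  have hfhom : ∀ m, (detPoly (Fin m) K).IsHomogeneous (detPoly (Fin m) K).totalDegree := by
    intro m
    by_cases h0 : detPoly (Fin m) K = 0
    · rw [h0]
      exact isHomogeneous_zero _ _ _
    · rw [hdeg m h0]
      simpa using detPoly_isHomogeneous (n := Fin m) (k := K)
  obtain ⟨c, hc⟩ := DepthReduction.homDepthFourCircuitSize_le_of_isVPFamily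
    (fun m => detPoly (Fin m) K) (isVPFamily_detPoly_of_commRing K) hfhom
  refine ⟨c, fun m => le_trans (hc m) ?_⟩
  have htd : (detPoly (Fin m) K).totalDegree ≤ m := by
    by_cases h0 : detPoly (Fin m) K = 0
    · rw [h0, totalDegree_zero]
      exact Nat.zero_le _
    · exact (hdeg m h0).le
  have h : (m + 2) ^ (c * Nat.sqrt (detPoly (Fin m) K).totalDegree + c) ≤
      (m + 2) ^ (c * Nat.sqrt m + c) :=
    Nat.pow_le_pow_right (by omega)
      (Nat.add_le_add_right (Nat.mul_le_mul_left c (Nat.sqrt_le_sqrt htd)) c)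
  exact_mod_cast h

/-- **The `det` twin of crux `Depth4HomFour` is FALSE** (the crux body with `perPoly ↦ detPoly`,
over any commutative ring in place of `ℂ`): take `c := c₀` of `exists_door_detPoly`.
[cite: Tavenas2015, Thm 1] -/
theorem not_depth4HomFour_detTwin :
    ¬ (∀ c : ℕ, ∃ m : ℕ, ((m + 2 : ℕ∞) ^ (c * Nat.sqrt m + c)) <
      homDepthFourCircuitSize (detPoly (Fin m) K)) := by
  obtain ⟨c, hc⟩ := exists_door_detPoly K
  intro h
  obtain ⟨m, hm⟩ := h c
  exact (not_lt.2 (hc m)) hm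

/-- Every door that `per_n` passes beyond `det`'s ceiling `c₀` separates `det_n` from `per_n` in
the crux's currency. [cite: Tavenas2015, Thm 1] -/
theorem detPoly_lt_perPoly_of_door :
    ∃ c : ℕ, ∀ n : ℕ, ((n + 2 : ℕ∞) ^ (c * Nat.sqrt n + c)) <
      homDepthFourCircuitSize (perPoly (Fin n) K) →
      homDepthFourCircuitSize (detPoly (Fin n) K) <
        homDepthFourCircuitSize (perPoly (Fin n) K) := by
  obtain ⟨c, hc⟩ := exists_door_detPoly K
  exact ⟨c, fun n hn => lt_of_le_of_lt (hc n) hn⟩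

end DetCeiling

/-! ### (B) The ceiling of `per`: Ryser's `ΣΠΣ` formula as a homogeneous `ΣΠΣΠ` circuit -/

section PerCeiling

variable (K : Type*) [CommRing K]

/-- **`per_n` has homogeneous `ΣΠΣΠ` circuits with `≤ n² + (n+1)·2^n + 1` gates** (Ryser:
`2^n` products of `n` row-local linear forms, the sign `(-1)^(n-|S|)` folded into row `0` as a
constant factor; layer 1 = the `n²` variables as monomial gates).
[cite: Ryser1963, Ch. 2 Thm 4.1] [cite: KumarSaraf2017, §3] -/
theorem homDepthFourCircuitSize_perPoly_le (n : ℕ) :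
    homDepthFourCircuitSize (perPoly (Fin n) K) ≤ (n ^ 2 + (n + 1) * 2 ^ n + 1 : ℕ) := by
  classical
  -- index the column sets by `Fin (2^n)`
  have hcard : Fintype.card (Finset (Fin n)) = 2 ^ n := by
    rw [Fintype.card_finset, Fintype.card_fin]
  let e : Finset (Fin n) ≃ Fin (2 ^ n) := Fintype.equivFinOfCardEq hcard
  -- the signs, folded into row `0`
  let sg : Finset (Fin n) → Fin n → K := fun S i => if (i : ℕ) = 0 then (-1) ^ (n - S.card) else 1
  have hsg : ∀ S : Finset (Fin n), ∏ i, sg S i = (-1) ^ (n - S.card) := by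
    intro S
    rcases Nat.eq_zero_or_pos n with hn | hn
    · subst hn
      simp [Finset.eq_empty_of_isEmpty S]
    · rw [Fintype.prod_eq_single (⟨0, hn⟩ : Fin n)]
      · simp [sg]
      · intro i hi
        have hi' : (i : ℕ) ≠ 0 := fun h => hi (Fin.ext h)
        simp [sg, hi']
  -- the pieces: `C (sign) · Σ_{j ∈ S} x_{ij}`
  set p : Fin (2 ^ n) → Fin n → MvPolynomial (Fin n × Fin n) K :=
    fun t i => C (sg (e.symm t) i) * ∑ j ∈ e.symm t, X (i, j) with hp
  -- (1) value: Ryser's formula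
  have hval : ∑ t, ∏ i, p t i = perPoly (Fin n) K := by
    rw [Summit.ValiantsHypothesis.ValiantsHypothesis.Theorems.RyserFormula.perPoly_eq_ryser,
      Finset.powerset_univ,
      ← Fintype.sum_equiv e (fun S => ∏ i, p (e S) i) (fun t => ∏ i, p t i) (fun S => rfl)]
    refine Finset.sum_congr rfl fun S _ => ?_
    simp only [hp, Equiv.symm_apply_apply]
    rw [Finset.prod_mul_distrib, ← map_prod C (sg S) univ, hsg S, map_pow, map_neg, map_one]
  -- (2) layer 1: the variables
  let U : Finset (Fin n × Fin n →₀ ℕ) := univ.image fun v => Finsupp.single v 1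
  have hU : U.card ≤ n ^ 2 := Finset.card_image_le.trans (by simp [sq])
  have hXU : ∀ v : Fin n × Fin n, (X v : MvPolynomial (Fin n × Fin n) K).support ⊆ U := by
    intro v
    show (monomial (Finsupp.single v 1) (1 : K)).support ⊆ U
    exact subset_trans support_monomial_subset
      (Finset.singleton_subset_iff.2
        (Finset.mem_image_of_mem (fun v : Fin n × Fin n => Finsupp.single v 1) (Finset.mem_univ v)))
  have hpU : ∀ t i, (p t i).support ⊆ U := by
    intro t i
    simp only [hp]
    rw [C_mul']
    exact subset_trans support_smul
      (subset_trans support_sum (Finset.biUnion_subset.2 fun j _ => hXU (i, j)))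
  -- (3) homogeneity: every piece is linear, the total is `per_n`, homogeneous of degree `n`
  have hhom : ∀ t i, ∃ d, (p t i).IsHomogeneous d := fun t i =>
    ⟨1, by
      simp only [hp]
      exact (IsHomogeneous.sum _ (fun j => (X (i, j) : MvPolynomial (Fin n × Fin n) K)) 1
        fun j _ => isHomogeneous_X K (i, j)).C_mul _⟩
  have hsum : ∃ d, (∑ t, ∏ i, p t i).IsHomogeneous d :=
    ⟨n, by rw [hval]; simpa using perPoly_isHomogeneous (n := Fin n) (k := K)⟩
  -- (4) the circuit
  obtain ⟨P, hPe, hP4, hPh, hPs⟩ :=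
    DepthReduction.exists_depthFour_circuit_sum_prod (2 ^ n) n p U hpU hhom hsum
  refine le_trans (homDepthFourCircuitSize_le (f := perPoly (Fin n) K) (P := P) (hPe.trans hval)
    hP4 hPh) ?_
  have hsize : P.size ≤ n ^ 2 + (n + 1) * 2 ^ n + 1 := by
    rw [hPs]
    have h1 : (n + 1) * 2 ^ n = 2 ^ n * n + 2 ^ n := by ring
    rw [h1]
    omega
  exact_mod_cast hsize

end PerCeiling

/-! ### (C) The crux is `per`-specific: it separates `per_n` from `det_n` at equal `n` -/

/-- **`Depth4HomFour ⟹ hom-ΣΠΣΠ separates `per_n` from `det_n`** (hypothesis = the crux body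
verbatim; witness: the crux at the door `c₀` of `exists_door_detPoly ℂ`).  A REFORMULATION of
`per`-specificity, not progress on crux 11333. [cite: Tavenas2015, Thm 1] [cite: KumarSaraf2017, §3] -/
theorem depth4HomFour_separates
    (h : ∀ c : ℕ, ∃ n : ℕ, ((n + 2 : ℕ∞) ^ (c * Nat.sqrt n + c)) <
      homDepthFourCircuitSize (perPoly (Fin n) ℂ)) :
    ∃ n : ℕ, homDepthFourCircuitSize (detPoly (Fin n) ℂ) <
      homDepthFourCircuitSize (perPoly (Fin n) ℂ) := by
  obtain ⟨c, hc⟩ := exists_door_detPoly ℂ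
  obtain ⟨n, hn⟩ := h c
  exact ⟨n, lt_of_le_of_lt (hc n) hn⟩

end Summit.ValiantsHypothesis.ValiantsHypothesis.Theorems.Depth4DoorCeilings

end
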